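import Summits.BirchSwinnertonDyer.Rank1Residual.Additive.CyclotomicQuadraticSubfield
import Literature.NumberTheory.EllipticCurves.BSDSelmerParityDokchitserBaseChangeProofs
import Literature.NumberTheory.EllipticCurves.ShaRestrictionIndex
import Literature.NumberTheory.EllipticCurves.LeadingTermPPartProofs
import Literature.NumberTheory.EllipticCurves.PAdicBSDKatoFiniteProofs
import Literature.NumberTheory.EllipticCurves.BSDInvariantsProofs
import Literature.NumberTheory.EllipticCurves.SelmerPInftyRestriction
import Literature.NumberTheory.EllipticCurves.BSDRootNumberSmallConductorProofs
import Mathlib.NumberTheory.Cyclotomic.Basic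
import HarnessLib

/-!
# `ord_p #Ш(V) + ord_p #Ш(W) ≤ ord_p #Sel_{p^∞}(V/ℚ(ζ_p))` for a quadratic-twist pair `W ≅ V^{(p*)}`
# of rank-`0` curves (cell `b2b-bsdres`, seat additive-p4, line V19: the descent step `ℚ → ℚ(μ_p)`)

HONEST FRAMING (cell `b2b-bsdres`, run/shared/lean/b2b/bsd-rank1-residual/, verbatim in every
file): the goal of the cell is to DELETE the COMBINATION-SHAPED residual classes of the
Birch–Swinnerton-Dyer formula for ALL analytic-rank `≤ 1` elliptic curves over `ℚ` — "full BSD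
formula for every rank `≤ 1` curve in class `C`" assembled STRICTLY from published theorems — so
that the rank-`≤ 1` remainder becomes exactly the CONSTRUCTION-SHAPED classes, which are TYPED
(missing-input `Prop`s), NOT attempted. This is not "finishing BSD". Seat additive-p4 (research route
on the construction-shaped additive classes X3/X4); no label moves; nothing is booked here.

Theorems only (no `def`, no `sorry`, no named fact). Line V19 bounds `#Sel_{p^∞}(V/F)`,
`F = ℚ(ζ_p)`, from ABOVE by the Iwasawa main-conjecture divisibility over `F_∞ = ℚ(ζ_{p^∞})` and
Greenberg's Euler characteristic over `F`; this file bounds it from BELOW by the two `ℚ`-curves: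

* §1 `natCard_primaryComponent_sha_dvd_of_coprime` — for ANY elliptic curve `X` over a number field
  `K` and a finite GALOIS extension `L/K` of degree prime to `p`, restriction
  `Ш(X/K)[p^∞] → Ш(X/L)[p^∞]` is injective (tree `injOn_shaRestriction_torsionBy`: `res c = 0 ⇒
  [L:K]·c = 0`, Serre, *Galois Cohomology* I.§2.4), so `#Ш(X/K)[p^∞] ∣ #Ш(X/L)[p^∞]`.
* §2 `padicValNat_shaOrder_add_le_selmer_cyclotomicPrime` — for `p` odd, `V, W/ℚ` of rank `0`
  (finite Mordell–Weil and `Ш`) with `W = C • V^{(p*)}`, `p* = (−1)^{(p−1)/2} p`, and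
  `Sel_{p^∞}(V/F)` finite: with `K' = ℚ(√p*) ⊂ F` THE quadratic subfield (tree
  `exists_sq_eq_pStar_and_finrank_eq_two`, the quadratic Gauss sum), the quadratic Selmer comparison
  `Sel_{p^∞}(V/ℚ) × Sel_{p^∞}(V^{(p*)}/ℚ) ≅ Sel_{p^∞}(V/K')` (Dokchitser–Dokchitser 2010, proof of
  Lemma 4.14, PROVED in the tree: kernel and cokernel killed by `8`, a bijection on `p`-primary groups
  for odd `p` — the step of line V18♯) gives `#Ш(V)[p^∞]·#Ш(W)[p^∞] = #Sel_{p^∞}(V/K') = #Ш(V/K')[p^∞]`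
  (rank `0`: `Sel = Ш[p^∞]`, tree `natCard_selmerGroupPInfty_eq_natCard_primaryComponent_sha`); then
  §1 along `F/K'` (Galois of degree `(p−1)/2`, prime to `p`) and `#Ш(V/F)[p^∞] = #Sel_{p^∞}(V/F)`
  (`V(F)` finite since `Sel_{p^∞}(V/F)` is, tree `finite_selmerGroupPInfty_iff`) give
  **`ord_p #Ш(V) + ord_p #Ш(W) ≤ ord_p #Sel_{p^∞}(V/F)`**.

No Milne/Weil-restriction identity, no Tamagawa or torsion datum over `K'` or `F` enters.

References: J.-P. Serre, *Galois Cohomology*, I.§2.4; T. and V. Dokchitser, Ann. of Math. 172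
(2010), Lemma 4.14; R. Greenberg, LNM 1716 (1999), §1 p. 54 (`Sel` vs `Ш` in rank `0`);
K. Ireland–M. Rosen, Prop. 6.3.2 (`g² = p*` in `ℚ(ζ_p)`).
-/

noncomputable section

open scoped Classical NumberField

open WeierstrassCurve Literature.NumberTheory.EllipticCurves NumberField

namespace Summit.BirchSwinnertonDyer.Rank1Residual.Additive

/-! ## §1 Restriction of `Ш[p^∞]` along a Galois extension of degree prime to `p` -/

section Restriction

variable {K : Type} [Field K] [NumberField K] (X : WeierstrassCurve K)
  (L : Type) [Field L] [NumberField L] [Algebra K L] (p : ℕ)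

/-- **`#Ш(X/K)[p^∞] ∣ #Ш(X/L)[p^∞]`** for a finite Galois extension `L/K` of degree prime to `p`
(with `Ш(X/L)[p^∞]` finite): restriction `Ш(X/K) → Ш(X/L)` maps the `p`-primary part into the
`p`-primary part and is injective on it — a class `c` killed by `p^k` with `res c = 0` satisfies
`[L:K]·c = 0` (corestriction), and `gcd(p^k, [L:K]) = 1` (tree `injOn_shaRestriction_torsionBy`).
[cite: SerreGaloisCohomology1997, I.§2.4 Cor. to Prop. 9] -/
theorem natCard_primaryComponent_sha_dvd_of_coprime [IsGalois K L]
    (hcop : (Module.finrank K L).Coprime p)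
    [Finite (AddCommGroup.primaryComponent (X.baseChange L).sha p)] :
    Nat.card (AddCommGroup.primaryComponent X.sha p) ∣
      Nat.card (AddCommGroup.primaryComponent (X.baseChange L).sha p) := by
  let ψ : AddCommGroup.primaryComponent X.sha p →+
      AddCommGroup.primaryComponent (X.baseChange L).sha p :=
    { toFun := fun c ↦ ⟨shaRestriction X L c, map_mem_primaryComponent (shaRestriction X L) c.2⟩
      map_zero' := by apply Subtype.ext; simp only [ZeroMemClass.coe_zero, map_zero]
      map_add' := fun a b ↦ by apply Subtype.ext; simp only [AddSubgroup.coe_add, map_add] }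
  have hψ : Function.Injective ψ := by
    intro a b hab
    obtain ⟨ka, hka⟩ := AddCommGroup.mem_primaryComponent.mp a.2
    obtain ⟨kb, hkb⟩ := AddCommGroup.mem_primaryComponent.mp b.2
    have ha : (a : X.sha) ∈ AddSubgroup.torsionBy X.sha ((p ^ (ka + kb) : ℕ) : ℤ) := by
      rw [AddSubgroup.torsionBy.nsmul_iff, pow_add, mul_comm, mul_smul, hka, smul_zero]
    have hb : (b : X.sha) ∈ AddSubgroup.torsionBy X.sha ((p ^ (ka + kb) : ℕ) : ℤ) := by
      rw [AddSubgroup.torsionBy.nsmul_iff, pow_add, mul_smul, hkb, smul_zero]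
    have hcopk : (p ^ (ka + kb)).Coprime (Module.finrank K L) :=
      Nat.Coprime.pow_left _ hcop.symm
    have h := congrArg (fun z : AddCommGroup.primaryComponent (X.baseChange L).sha p ↦
      (z : (X.baseChange L).sha)) hab
    exact Subtype.ext (injOn_shaRestriction_torsionBy X L hcopk ha hb h)
  exact AddSubgroup.card_dvd_of_injective ψ hψ

end Restriction

/-! ## §2 The twist pair over `ℚ` versus `Sel_{p^∞}(V/ℚ(ζ_p))` -/

section CyclotomicPrime

variable (p : ℕ) [hp : Fact p.Prime] (F : Type) [Field F] [NumberField F] [IsCyclotomicExtension {p} ℚ F]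
  (V : WeierstrassCurve ℚ) [V.IsElliptic] (W : WeierstrassCurve ℚ)

/-- An element killed by two coprime naturals is zero. [folklore] -/
private theorem eq_zero_of_nsmul_eq_zero_of_coprime' {G : Type*} [AddCommGroup G]
    {m n : ℕ} (h : m.Coprime n) {x : G} (hm : m • x = 0) (hn : n • x = 0) : x = 0 := by
  have h1 : (Nat.gcd m n) • x = 0 := by
    obtain ⟨a, b, hab⟩ : ∃ a b : ℤ, (Nat.gcd m n : ℤ) = m * a + n * b :=
      ⟨Nat.gcdA m n, Nat.gcdB m n, Nat.gcd_eq_gcd_ab m n⟩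
    have : ((Nat.gcd m n : ℤ)) • x = 0 := by
      rw [hab, add_zsmul, mul_comm (m : ℤ), mul_comm (n : ℤ), mul_zsmul, mul_zsmul,
        natCast_zsmul, natCast_zsmul, hm, hn, zsmul_zero, zsmul_zero, add_zero]
    exact_mod_cast this
  rwa [h, one_smul] at h1

/-- If `n • x = 0` with `n` coprime to `m`, then `x = a • (m • x)` for some integer `a`. [folklore] -/
private theorem exists_zsmul_nsmul_eq_of_coprime' {G : Type*} [AddCommGroup G]
    {m n : ℕ} (h : m.Coprime n) {x : G} (hn : n • x = 0) : ∃ a : ℤ, a • (m • x) = x := by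
  refine ⟨Nat.gcdA m n, ?_⟩
  have hab := Nat.gcd_eq_gcd_ab m n
  rw [h] at hab
  have key : ((1 : ℕ) : ℤ) • x = (m * Nat.gcdA m n + n * Nat.gcdB m n : ℤ) • x := by rw [← hab]
  rw [natCast_zsmul, one_smul, add_zsmul, mul_comm (m : ℤ), mul_comm (n : ℤ), mul_zsmul, mul_zsmul,
    natCast_zsmul, natCast_zsmul, hn, zsmul_zero, add_zero] at key
  exact key.symm

/-- `[ℚ(ζ_p) : ℚ] = p − 1` (Mathlib `IsCyclotomicExtension.finrank`). [folklore] -/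
private theorem finrank_cyclotomic_eq_sub_one : Module.finrank ℚ F = p - 1 := by
  haveI : NeZero p := ⟨hp.out.ne_zero⟩
  rw [IsCyclotomicExtension.finrank F (Polynomial.cyclotomic.irreducible_rat (NeZero.pos p)),
    Nat.totient_prime hp.out]

/-- **Line V19, the descent step `ℚ → ℚ(μ_p)`.** Let `p` be an odd prime, `F = ℚ(ζ_p)`, and let
`V, W/ℚ` be elliptic curves with finite Mordell–Weil groups and finite `Ш` (rank `0`), `W` a model
of the quadratic twist of `V` by `p* = (−1)^{(p−1)/2} p` (`C • V^{(p*)} = W`). If `Sel_{p^∞}(V/F)` is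
finite then **`ord_p #Ш(V) + ord_p #Ш(W) ≤ ord_p #Sel_{p^∞}(V/F)`**: with `K' = ℚ(√p*) ⊂ F`,
`#Ш(V)[p^∞]·#Ш(W)[p^∞] = #Sel_{p^∞}(V)·#Sel_{p^∞}(V^{(p*)}) = #Sel_{p^∞}(V/K') = #Ш(V/K')[p^∞]`
(Dokchitser–Dokchitser comparison, bijective on `p`-primary groups for odd `p`; rank `0`) and
`#Ш(V/K')[p^∞] ∣ #Ш(V/F)[p^∞] = #Sel_{p^∞}(V/F)` (`F/K'` Galois of degree `(p−1)/2` prime to `p`;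
`V(F)` finite). [cite: DokchitserDokchitserAnnals2010, Lemma 4.14 (proof)]
[cite: SerreGaloisCohomology1997, I.§2.4 Cor. to Prop. 9] [cite: GreenbergLNM1716, §1 p. 54] -/
theorem padicValNat_shaOrder_add_le_selmer_cyclotomicPrime (hp2 : p ≠ 2)
    (C : VariableChange ℚ) (hC : C • V.quadraticTwist ((-1 : ℚ) ^ (p / 2) * p) = W)
    [Finite V.toAffine.Point] [Finite W.toAffine.Point] (hfinV : Finite V.sha) (hfinW : Finite W.sha)
    (hfin : Finite ((V.baseChange F).selmerGroupPInfty p)) :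
    padicValNat p V.shaOrder + padicValNat p W.shaOrder ≤
      padicValNat p (Nat.card ((V.baseChange F).selmerGroupPInfty p)) := by
  haveI : Finite V.sha := hfinV
  haveI : Finite W.sha := hfinW
  haveI : NeZero p := ⟨hp.out.ne_zero⟩
  set d : ℚ := (-1 : ℚ) ^ (p / 2) * p with hd
  -- §A the quadratic subfield `K' = ℚ(g)`, `g² = p*`
  obtain ⟨g, hg, h2⟩ := exists_sq_eq_pStar_and_finrank_eq_two p (L := F) hp2
  set K' : IntermediateField ℚ F := IntermediateField.adjoin ℚ {g} with hK'
  haveI : NumberField K' := NumberField.of_module_finite ℚ K'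
  set θ : K' := ⟨g, IntermediateField.mem_adjoin_simple_self ℚ g⟩ with hθdef
  have hθsq : θ ^ 2 = algebraMap ℚ K' d := by
    apply Subtype.ext
    change g ^ 2 = ((algebraMap ℚ K' d : K') : F)
    rw [hg, hd]
    change _ = algebraMap ℚ F ((-1 : ℚ) ^ (p / 2) * p)
    simp only [map_mul, map_pow, map_neg, map_one, map_natCast]
  have hθ : θ ∉ Set.range (algebraMap ℚ K') := by
    rintro ⟨q, hq⟩
    have hqg : (algebraMap ℚ F q) = g := by
      have := congrArg (fun z : K' ↦ (z : F)) hq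
      exact this
    have : (q : F) ^ 2 = (-1 : F) ^ (p / 2) * p := by
      rw [← hg, ← hqg]; rfl
    have hQ : (q ^ 2 : ℚ) = (-1 : ℚ) ^ (p / 2) * p := by
      have h' : ((q ^ 2 : ℚ) : F) = (((-1 : ℚ) ^ (p / 2) * p : ℚ) : F) := by push_cast; exact this
      exact_mod_cast h'
    exact forall_sq_ne_pStar p q hQ
  -- §B the comparison map `Sel(V) × Sel(V^{(d)}) → Sel(V_{K'})`, bijective for odd `p`
  set VK := V.baseChange K' with hVK
  set Vt : WeierstrassCurve ℚ := V.quadraticTwist d with hVt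
  have hd0 : d ≠ 0 := by
    rw [hd]
    exact mul_ne_zero (pow_ne_zero _ (by norm_num)) (by exact_mod_cast hp.out.ne_zero)
  haveI hVtE : Vt.IsElliptic := V.isElliptic_quadraticTwist hd0
  haveI hEVt : Finite Vt.toAffine.Point := by
    have hEW : Finite W.toAffine.Point := inferInstance
    rw [← hC] at hEW
    exact Finite.of_equiv _ (VariableChange.pointEquiv Vt C).toEquiv.symm
  haveI hfinVt : Finite Vt.sha := (Equiv.finite_iff (shaEquiv Vt C)).mpr (by rw [hC]; exact hfinW)
  set Φ := comparisonMap V K' hθ hθsq p with hΦ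
  have h8p : ∀ k : ℕ, Nat.Coprime 8 (p ^ k) := fun k ↦ by
    refine Nat.Coprime.pow_right k ?_
    have h2p : Nat.Coprime 2 p := (Nat.coprime_primes Nat.prime_two hp.out).mpr (Ne.symm hp2)
    simpa using (h2p.pow_left 3)
  have hΦinj : Function.Injective Φ := by
    intro x y hxy
    have h0 : Φ (x - y) = 0 := by rw [map_sub, hxy, sub_self]
    have h8 := nsmul_eq_zero_of_comparisonMap_eq_zero V K' h2 hθ hθsq p (x - y) h0
    obtain ⟨k₁, hk₁⟩ := exists_pow_nsmul_eq_zero_galH1Primary V p ((x - y).1 : galH1Primary V p)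
    obtain ⟨k₂, hk₂⟩ := exists_pow_nsmul_eq_zero_galH1Primary Vt p ((x - y).2 : galH1Primary Vt p)
    have hk : (p ^ (k₁ + k₂)) • (x - y) = 0 := by
      refine Prod.ext (Subtype.ext ?_) (Subtype.ext ?_)
      · change (p ^ (k₁ + k₂)) • ((x - y).1 : galH1Primary V p) = 0
        rw [pow_add, mul_comm, mul_smul, hk₁, smul_zero]
      · change (p ^ (k₁ + k₂)) • ((x - y).2 : galH1Primary Vt p) = 0
        rw [pow_add, mul_smul, hk₂, smul_zero]
    exact sub_eq_zero.mp (eq_zero_of_nsmul_eq_zero_of_coprime' (h8p _) h8 hk)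
  have hΦsurj : Function.Surjective Φ := by
    intro s
    obtain ⟨x, hx⟩ := nsmul_mem_range_comparisonMap V K' h2 hθ hθsq p s
    obtain ⟨k, hk⟩ := exists_pow_nsmul_eq_zero_galH1Primary VK p (s : galH1Primary VK p)
    have hk' : (p ^ k) • s = 0 := Subtype.ext (by
      rw [AddSubmonoidClass.coe_nsmul, ZeroMemClass.coe_zero]; exact hk)
    obtain ⟨a, ha⟩ := exists_zsmul_nsmul_eq_of_coprime' (h8p k) hk'
    exact ⟨a • x, by rw [map_zsmul, hx, ha]⟩
  have hcardSel : Nat.card (VK.selmerGroupPInfty p) =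
      Nat.card (V.selmerGroupPInfty p) * Nat.card (Vt.selmerGroupPInfty p) := by
    rw [← Nat.card_prod]
    exact (Nat.card_congr (Equiv.ofBijective Φ ⟨hΦinj, hΦsurj⟩)).symm
  -- §C rank `0` over `ℚ`: `Sel = Ш[p^∞]`, and `#Ш(V^{(d)}) = #Ш(W)`
  have hSelV : Nat.card (V.selmerGroupPInfty p) = Nat.card (AddCommGroup.primaryComponent V.sha p) :=
    V.natCard_selmerGroupPInfty_eq_natCard_primaryComponent_sha p
  have hSelVt : Nat.card (Vt.selmerGroupPInfty p) = Nat.card (AddCommGroup.primaryComponent Vt.sha p) :=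
    Vt.natCard_selmerGroupPInfty_eq_natCard_primaryComponent_sha p
  have hShaVt : Vt.shaOrder = W.shaOrder := by
    have h := shaOrder_variableChange_holds Vt C
    rw [shaOrder_variableChange, hC] at h
    exact h.symm
  have hposV : 0 < Nat.card (V.selmerGroupPInfty p) := by rw [hSelV]; exact Nat.card_pos
  have hposVt : 0 < Nat.card (Vt.selmerGroupPInfty p) := by rw [hSelVt]; exact Nat.card_pos
  -- §D `Sel(V_{K'})` finite, `V(K')` finite, `Sel(V_{K'}) = Ш(V_{K'})[p^∞]`
  have hposK : 0 < Nat.card (VK.selmerGroupPInfty p) := by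
    rw [hcardSel]; exact Nat.mul_pos hposV hposVt
  haveI hfinK : Finite (VK.selmerGroupPInfty p) := Nat.finite_of_card_ne_zero hposK.ne'
  haveI hEK : Finite VK.toAffine.Point := ((VK.finite_selmerGroupPInfty_iff p).mp hfinK).1
  have hSelK : Nat.card (VK.selmerGroupPInfty p) =
      Nat.card (AddCommGroup.primaryComponent VK.sha p) :=
    VK.natCard_selmerGroupPInfty_eq_natCard_primaryComponent_sha p
  -- §E restriction `K' → F` (Galois, degree `(p-1)/2` prime to `p`)
  haveI : IsGalois ℚ F := IsCyclotomicExtension.isGalois {p} ℚ F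
  haveI : IsGalois K' F := IsGalois.tower_top_of_isGalois ℚ K' F
  have hcop : (Module.finrank K' F).Coprime p := by
    have hmul : Module.finrank ℚ K' * Module.finrank K' F = p - 1 := by
      rw [Module.finrank_mul_finrank, finrank_cyclotomic_eq_sub_one p F]
    have hdvd : Module.finrank K' F ∣ p - 1 := ⟨Module.finrank ℚ K', by rw [mul_comm, hmul]⟩
    have hcp : (p - 1).Coprime p :=
      ((Nat.Prime.coprime_iff_not_dvd hp.out).mpr (Nat.not_dvd_of_pos_of_lt
        (Nat.sub_pos_of_lt hp.out.one_lt) (Nat.sub_lt hp.out.pos Nat.one_pos))).symm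
    exact Nat.Coprime.coprime_dvd_left hdvd hcp
  haveI hfinF : Finite ((V.baseChange F).selmerGroupPInfty p) := hfin
  haveI hEF : Finite (V.baseChange F).toAffine.Point :=
    (((V.baseChange F).finite_selmerGroupPInfty_iff p).mp hfinF).1
  haveI hShaF : Finite (AddCommGroup.primaryComponent (V.baseChange F).sha p) :=
    (((V.baseChange F).finite_selmerGroupPInfty_iff p).mp hfinF).2
  have hbc : VK.baseChange F = V.baseChange F := by
    rw [hVK]
    exact Literature.NumberTheory.EllipticCurves.baseChange_baseChange V K' F
  haveI : Finite (AddCommGroup.primaryComponent (VK.baseChange F).sha p) := by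
    rw [hbc]; exact hShaF
  have hdvdF : Nat.card (AddCommGroup.primaryComponent VK.sha p) ∣
      Nat.card (AddCommGroup.primaryComponent (V.baseChange F).sha p) := by
    have h := natCard_primaryComponent_sha_dvd_of_coprime VK F p hcop
    rwa [hbc] at h
  have hSelF : Nat.card ((V.baseChange F).selmerGroupPInfty p) =
      Nat.card (AddCommGroup.primaryComponent (V.baseChange F).sha p) :=
    (V.baseChange F).natCard_selmerGroupPInfty_eq_natCard_primaryComponent_sha p
  have hposF : 0 < Nat.card ((V.baseChange F).selmerGroupPInfty p) := by
    rw [hSelF]; exact Nat.card_pos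
  -- §F valuations
  have hvK : padicValNat p (Nat.card (VK.selmerGroupPInfty p)) =
      padicValNat p V.shaOrder + padicValNat p W.shaOrder := by
    rw [hcardSel, padicValNat.mul hposV.ne' hposVt.ne', hSelV, hSelVt,
      padicValNat_card_addPrimaryComponent p, padicValNat_card_addPrimaryComponent p, ← hShaVt]
    rfl
  have hle : padicValNat p (Nat.card (VK.selmerGroupPInfty p)) ≤
      padicValNat p (Nat.card ((V.baseChange F).selmerGroupPInfty p)) := by
    rw [← padicValNat_dvd_iff_le hposF.ne', hSelF]
    rw [hSelK]
    exact pow_padicValNat_dvd.trans hdvdF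
  rw [hvK] at hle
  exact hle

end CyclotomicPrime

end Summit.BirchSwinnertonDyer.Rank1Residual.Additive

end
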